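import Literature.Geometry.Kaehler.ComplexTorusCyclotomicCharpolyFifteenHodge
import Mathlib.RingTheory.Polynomial.Cyclotomic.Expand
import HarnessLib

/-!
# Complex tori with an endomorphism of characteristic polynomial `Φ₃₀`: `P_{−u} = Φ₁₅`, so they are the four tori of the
# `Φ₁₅` file — exactly four, one simple, isomorphic iff isogenous, `Hdg = Div` on all powers

Layer `Literature/Geometry/Kaehler`, namespace `Literature.Geometry.Kaehler.ComplexTorus`; lane `lit-hodgefound` (Track 2
foundations library), prover seat `lit-hodgefound-p10`, generation 33, row «A2-26(ha)» (self-proposed 2026-08-28).  Theorems only;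
no `def`, no instance, no named fact (net Literature debt 0).  The fifth cyclotomic polynomial of degree `8` is
`Φ₃₀(X) = Φ₁₅(−X)` (`ℚ(ζ₃₀) = ℚ(ζ₁₅)`, `ζ₃₀ = −ζ₁₅⁸`): an endomorphism `u` with `P_u = Φ₃₀` has `P_{−u} = Φ₁₅` (minimal
polynomial argument over `ℚ`: `Φ₁₅(−u) = Φ₃₀(u) = 0`, `Φ₁₅` irreducible of degree `8 = rk Λ`), and `−u ∈ End(X)`; so the
classification and the Hodge statements of `ComplexTorusCyclotomicCharpolyFifteen(Hodge)` transfer verbatim.  Together with the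
`Φ₁₅`, `Φ₁₆`, `Φ₂₀`, `Φ₂₄` files: EVERY complex torus carrying an endomorphism whose characteristic polynomial is a cyclotomic
polynomial of degree `8` (`d ∈ {15, 16, 20, 24, 30}`) has the Hodge classes of all its powers generated by divisor classes.

* §1 `cyclotomic_fifteen_int` (`Φ₁₅ = X⁸ − X⁷ + X⁵ − X⁴ + X³ − X + 1`), `cyclotomic_thirty_int`
  (`Φ₃₀ = X⁸ + X⁷ − X⁵ − X⁴ − X³ + X + 1`), `cyclotomic_fifteen_comp_neg_X` (`Φ₁₅(−X) = Φ₃₀`), `cyclotomic_thirty_comp_neg_X`.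
* §2 **`charpoly_neg_eq_cyclotomic_fifteen_of_charpoly_eq_cyclotomic_thirty`** (`P_A = Φ₃₀ ⟹ P_{−A} = Φ₁₅`, integer matrices of
  any size) and the converse `charpoly_neg_eq_cyclotomic_thirty_of_charpoly_eq_cyclotomic_fifteen`.
* §3 the pairs `(X, u)` with `P_u = Φ₃₀`: `finrank_eq_four_of_charpoly_eq_cyclotomic_thirty`,
  **`isIsomorphic_iff_isIsogenous_of_charpoly_eq_cyclotomic_thirty`**, **`IsSimple.isIsomorphic_of_charpoly_eq_cyclotomic_thirty`**,
  `exists_isIsogenous_pow_of_not_isSimple_of_charpoly_eq_cyclotomic_thirty`,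
  **`exists_four_forall_isIsomorphic_of_charpoly_eq_cyclotomic_thirty`** (EXACTLY FOUR complex tori admit an endomorphism with
  `P_u = Φ₃₀` — the same four as for `Φ₁₅`), `mtRank_hodgeStructure_eq_five_iff_isSimple_of_charpoly_eq_cyclotomic_thirty`,
  **`divisorClasses_powPeriod_eq_hodgeClasses_of_charpoly_eq_cyclotomic_thirty`**.

## References

* [Shimura1998] G. Shimura, *Abelian Varieties with Complex Multiplication and Modular Functions* (1998), §6.1 Thm. 2
  p. 41, §6.2 Thm. 3, §7.4 Prop. 17 p. 58, §8.2 Prop. 26, §8.4 Examples (1)–(2).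
* [BirkenhakeLange2004] Ch. Birkenhake, H. Lange, *Complex Abelian Varieties*, 2nd ed. (2004), §13.3 (and Cor. 13.3.4: `u ↦ −u`).
* [Washington1997] L. C. Washington, *Introduction to Cyclotomic Fields*, 2nd ed. (1997), Ch. 2 (`Φ_{2n}(X) = Φ_n(−X)` for odd
  `n > 1`), Thm. 11.1.
* [Dodson1984] B. Dodson, *The structure of Galois groups of CM-fields*, Trans. AMS 283 (1984), §3.3.2 Theorem p. 16.
* [MoonenZarhin1999LowDim] B. Moonen, Yu. Zarhin, *Hodge classes on abelian varieties of low dimension*, Math. Ann. 315 (1999), Thm. 0.1.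
-/

noncomputable section

open scoped Classical nonZeroDivisors NumberField Manifold ContDiff MatrixGroups
open NumberField Module Polynomial

namespace Literature.Geometry.Kaehler

namespace ComplexTorus

open Literature.AlgebraicGeometry.Motives (CMType HodgeTensorFacts)
open Literature.NumberTheory.ComplexMultiplication.CMTypeLattice (periodIso)

/-! ### §1 The polynomials `Φ₁₅`, `Φ₃₀` -/

/-- **`Φ₁₅ = X⁸ − X⁷ + X⁵ − X⁴ + X³ − X + 1`** (from `Φ₃(X⁵) = Φ₁₅ Φ₃`). [cite: Washington1997, Ch. 2 (cyclotomic polynomials)] -/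
theorem cyclotomic_fifteen_int : cyclotomic 15 ℤ = X ^ 8 - X ^ 7 + X ^ 5 - X ^ 4 + X ^ 3 - X + 1 := by
  have h := cyclotomic_expand_eq_cyclotomic_mul Nat.prime_five (by norm_num : ¬ 5 ∣ 3) ℤ
  rw [show (3 * 5 : ℕ) = 15 by norm_num, cyclotomic_three] at h
  have hexp : expand ℤ 5 (X ^ 2 + X + 1 : ℤ[X]) = X ^ 10 + X ^ 5 + 1 := by
    simp [expand_X]
    ring
  rw [hexp] at h
  have hne : (X ^ 2 + X + 1 : ℤ[X]) ≠ 0 := by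
    rw [← cyclotomic_three]; exact cyclotomic_ne_zero 3 ℤ
  apply mul_right_cancel₀ hne
  rw [← h]
  ring

/-- **`Φ₃₀ = X⁸ + X⁷ − X⁵ − X⁴ − X³ + X + 1`** (from `Φ₁₅(X²) = Φ₃₀ Φ₁₅`). [cite: Washington1997, Ch. 2 (cyclotomic polynomials)] -/
theorem cyclotomic_thirty_int : cyclotomic 30 ℤ = X ^ 8 + X ^ 7 - X ^ 5 - X ^ 4 - X ^ 3 + X + 1 := by
  have h := cyclotomic_expand_eq_cyclotomic_mul Nat.prime_two (by norm_num : ¬ 2 ∣ 15) ℤ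
  rw [show (15 * 2 : ℕ) = 30 by norm_num, cyclotomic_fifteen_int] at h
  have hexp : expand ℤ 2 (X ^ 8 - X ^ 7 + X ^ 5 - X ^ 4 + X ^ 3 - X + 1 : ℤ[X]) =
      X ^ 16 - X ^ 14 + X ^ 10 - X ^ 8 + X ^ 6 - X ^ 2 + 1 := by
    simp [expand_X]
    ring
  rw [hexp] at h
  have hne : (X ^ 8 - X ^ 7 + X ^ 5 - X ^ 4 + X ^ 3 - X + 1 : ℤ[X]) ≠ 0 := by
    rw [← cyclotomic_fifteen_int]; exact cyclotomic_ne_zero 15 ℤ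
  apply mul_right_cancel₀ hne
  rw [← h]
  ring

/-- **`Φ₁₅(−X) = Φ₃₀`** (`Φ_{2n}(X) = Φ_n(−X)` for odd `n > 1`, the case `n = 15`). [cite: Washington1997, Ch. 2 (cyclotomic polynomials)] -/
theorem cyclotomic_fifteen_comp_neg_X : (cyclotomic 15 ℤ).comp (-X) = cyclotomic 30 ℤ := by
  rw [cyclotomic_fifteen_int, cyclotomic_thirty_int]
  simp [sub_comp, add_comp]
  ring

/-- **`Φ₃₀(−X) = Φ₁₅`.** [cite: Washington1997, Ch. 2 (cyclotomic polynomials)] -/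
theorem cyclotomic_thirty_comp_neg_X : (cyclotomic 30 ℤ).comp (-X) = cyclotomic 15 ℤ := by
  rw [cyclotomic_fifteen_int, cyclotomic_thirty_int]
  simp [sub_comp, add_comp]
  ring

/-! ### §2 `P_A = Φ₃₀ ⟹ P_{−A} = Φ₁₅` for integer matrices -/

section MatrixAlgebra

variable {ι : Type} [Fintype ι] [DecidableEq ι]

/-- The minimal-polynomial argument: if `P_A = Φ_m`, `Φ_n(−X) = Φ_m` and `φ(n) = φ(m)`, then `P_{−A} = Φ_n` (`Φ_n(−A) = Φ_m(A) = 0`,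
`Φ_n` irreducible over `ℚ`, `deg = rk`). [cite: Washington1997, Ch. 2] [cite: BirkenhakeLange2004, §13.3 Cor. 13.3.4] -/
private theorem charpoly_neg_eq_cyclotomic_of_comp_neg_X {m n : ℕ} (hm : 0 < m) (hn : 0 < n)
    (hcomp : (cyclotomic n ℤ).comp (-X) = cyclotomic m ℤ) (htot : Nat.totient n = Nat.totient m) {A : Matrix ι ι ℤ}
    (hP : A.charpoly = cyclotomic m ℤ) : (-A).charpoly = cyclotomic n ℤ := by
  -- the size of the matrix
  have hcard : Fintype.card ι = Nat.totient m := by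
    rw [← Matrix.charpoly_natDegree_eq_dim A, hP, natDegree_cyclotomic]
  have hpos : 0 < Fintype.card ι := by rw [hcard]; exact Nat.totient_pos.2 hm
  haveI : Nonempty ι := Fintype.card_pos_iff.1 hpos
  -- over `ℚ`
  set F : Matrix ι ι ℤ →+* Matrix ι ι ℚ := (Int.castRingHom ℚ).mapMatrix with hF
  have hB : (F A).charpoly = cyclotomic m ℚ := by
    rw [hF, RingHom.mapMatrix_apply, Matrix.charpoly_map, hP, map_cyclotomic_int]
  have haeval : aeval (-(F A)) (cyclotomic n ℚ) = 0 := by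
    have h1 : aeval (F A) (cyclotomic m ℚ) = 0 := by rw [← hB]; exact Matrix.aeval_self_charpoly _
    have h2 : (cyclotomic n ℚ).comp (-X) = cyclotomic m ℚ := by
      rw [← map_cyclotomic_int n ℚ, ← map_cyclotomic_int m ℚ, ← hcomp, Polynomial.map_comp]
      simp
    rw [← h2, aeval_comp] at h1
    simpa using h1
  have hmin : minpoly ℚ (-(F A)) = cyclotomic n ℚ :=
    (minpoly.eq_of_irreducible_of_monic (cyclotomic.irreducible_rat hn) haeval (cyclotomic.monic n ℚ)).symm
  have hdvd : cyclotomic n ℚ ∣ (-(F A)).charpoly := hmin ▸ Matrix.minpoly_dvd_charpoly _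
  have hQ : (-(F A)).charpoly = cyclotomic n ℚ := by
    refine eq_of_monic_of_dvd_of_natDegree_le (cyclotomic.monic _ ℚ) (Matrix.charpoly_monic _) hdvd ?_
    rw [Matrix.charpoly_natDegree_eq_dim, natDegree_cyclotomic, hcard, htot]
  -- back to `ℤ`
  apply Polynomial.map_injective (Int.castRingHom ℚ) (Int.castRingHom ℚ).injective_int
  rw [map_cyclotomic_int, ← Matrix.charpoly_map, ← hQ, ← map_neg F A, hF, RingHom.mapMatrix_apply]

/-- **`P_A = Φ₃₀ ⟹ P_{−A} = Φ₁₅`** for an integer matrix `A` (of size `8`). [cite: BirkenhakeLange2004, §13.3 Cor. 13.3.4]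
[cite: Washington1997, Ch. 2] -/
theorem charpoly_neg_eq_cyclotomic_fifteen_of_charpoly_eq_cyclotomic_thirty {A : Matrix ι ι ℤ}
    (hP : A.charpoly = cyclotomic 30 ℤ) : (-A).charpoly = cyclotomic 15 ℤ :=
  charpoly_neg_eq_cyclotomic_of_comp_neg_X (by norm_num) (by norm_num) cyclotomic_fifteen_comp_neg_X (by decide) hP

/-- **`P_A = Φ₁₅ ⟹ P_{−A} = Φ₃₀`.** [cite: BirkenhakeLange2004, §13.3 Cor. 13.3.4] [cite: Washington1997, Ch. 2] -/
theorem charpoly_neg_eq_cyclotomic_thirty_of_charpoly_eq_cyclotomic_fifteen {A : Matrix ι ι ℤ}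
    (hP : A.charpoly = cyclotomic 15 ℤ) : (-A).charpoly = cyclotomic 30 ℤ :=
  charpoly_neg_eq_cyclotomic_of_comp_neg_X (by norm_num) (by norm_num) cyclotomic_thirty_comp_neg_X (by decide) hP

end MatrixAlgebra

/-! ### §3 The pairs `(X, u)` with `P_u = Φ₃₀` are the pairs `(X, −u)` with `P_{−u} = Φ₁₅` -/

section Thirty

variable {ι : Type} [Fintype ι] [DecidableEq ι] {E : Type} [NormedAddCommGroup E] [NormedSpace ℂ E]
  {P : (ι → ℝ) ≃L[ℝ] E} {ι' : Type} [Fintype ι'] [DecidableEq ι'] {E' : Type} [NormedAddCommGroup E']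
  [NormedSpace ℂ E'] {P' : (ι' → ℝ) ≃L[ℝ] E'}

omit [DecidableEq ι] in
/-- **`P_u = Φ₃₀` forces `dim X = 4`.** [cite: BirkenhakeLange2004, §13.3] -/
theorem finrank_eq_four_of_charpoly_eq_cyclotomic_thirty [DecidableEq ι] (P : (ι → ℝ) ≃L[ℝ] E) {A : Matrix ι ι ℤ}
    (hP : A.charpoly = cyclotomic 30 ℤ) : finrank ℂ E = 4 := by
  have h := two_mul_finrank_eq_totient_of_charpoly_eq_cyclotomic P hP
  have h30 : Nat.totient 30 = 8 := by decide
  omega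

/-- **TWO COMPLEX TORI WITH ENDOMORPHISMS OF CHARACTERISTIC POLYNOMIAL `Φ₃₀` ARE ISOMORPHIC IFF THEY ARE ISOGENOUS** (apply the
`Φ₁₅` statement to `−u`, `−u′`). [cite: Shimura1998, §6.1 Thm. 2 p. 41, §7.4 Prop. 17 p. 58] [cite: BirkenhakeLange2004, §13.3] -/
theorem isIsomorphic_iff_isIsogenous_of_charpoly_eq_cyclotomic_thirty {A : Matrix ι ι ℤ} (hA : A ∈ endRingInt P)
    (hP : A.charpoly = cyclotomic 30 ℤ) {A' : Matrix ι' ι' ℤ} (hA' : A' ∈ endRingInt P')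
    (hP' : A'.charpoly = cyclotomic 30 ℤ) : IsIsomorphic P P' ↔ IsIsogenous P P' :=
  isIsomorphic_iff_isIsogenous_of_charpoly_eq_cyclotomic_fifteen ((endRingInt P).neg_mem hA)
    (charpoly_neg_eq_cyclotomic_fifteen_of_charpoly_eq_cyclotomic_thirty hP) ((endRingInt P').neg_mem hA')
    (charpoly_neg_eq_cyclotomic_fifteen_of_charpoly_eq_cyclotomic_thirty hP')

/-- **THERE IS ONLY ONE SIMPLE COMPLEX TORUS WITH AN ENDOMORPHISM OF CHARACTERISTIC POLYNOMIAL `Φ₃₀`** (it is the simple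
ζ₁₅-fourfold). [cite: Shimura1998, §7.4 Prop. 17 p. 58, §8.2 Prop. 26, §8.4 Examples (1)–(2)] [cite: BirkenhakeLange2004, §13.3] -/
theorem IsSimple.isIsomorphic_of_charpoly_eq_cyclotomic_thirty (hX : ComplexTorus.IsSimple P) {A : Matrix ι ι ℤ}
    (hA : A ∈ endRingInt P) (hP : A.charpoly = cyclotomic 30 ℤ) (hX' : ComplexTorus.IsSimple P')
    {A' : Matrix ι' ι' ℤ} (hA' : A' ∈ endRingInt P') (hP' : A'.charpoly = cyclotomic 30 ℤ) :
    IsIsomorphic P P' :=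
  hX.isIsomorphic_of_charpoly_eq_cyclotomic_fifteen ((endRingInt P).neg_mem hA)
    (charpoly_neg_eq_cyclotomic_fifteen_of_charpoly_eq_cyclotomic_thirty hP) hX' ((endRingInt P').neg_mem hA')
    (charpoly_neg_eq_cyclotomic_fifteen_of_charpoly_eq_cyclotomic_thirty hP')

/-- **A NON-SIMPLE COMPLEX TORUS WITH AN ENDOMORPHISM OF CHARACTERISTIC POLYNOMIAL `Φ₃₀` IS `∼ B²` OR `∼ E⁴`** (`B` the simple
CM surface of `ℚ(ζ₅)`, `E` a CM elliptic curve of `ℚ(√−15)` or `ℚ(√−3)`). [cite: Shimura1998, §6.2 Thm. 3, §8.2 Prop. 26]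
[cite: BirkenhakeLange2004, §13.3] -/
theorem exists_isIsogenous_pow_of_not_isSimple_of_charpoly_eq_cyclotomic_thirty {A : Matrix ι ι ℤ}
    (hA : A ∈ endRingInt P) (hP : A.charpoly = cyclotomic 30 ℤ) (hns : ¬ ComplexTorus.IsSimple P) :
    (∃ (K₁ : IntermediateField ℚ (CyclotomicField 15 ℚ)) (Φ₁ : CMType K₁), finrank ℚ K₁ = 4 ∧
      ∀ I₁ : (FractionalIdeal (𝓞 K₁)⁰ K₁)ˣ,
        ComplexTorus.IsSimple (periodIso Φ₁ I₁) ∧ IsIsogenous P (powPeriod (periodIso Φ₁ I₁) 2)) ∨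
    (∃ (K₁ : IntermediateField ℚ (CyclotomicField 15 ℚ)) (Φ₁ : CMType K₁), finrank ℚ K₁ = 2 ∧
      ∀ I₁ : (FractionalIdeal (𝓞 K₁)⁰ K₁)ˣ,
        ComplexTorus.IsSimple (periodIso Φ₁ I₁) ∧ IsIsogenous P (powPeriod (periodIso Φ₁ I₁) 4)) :=
  exists_isIsogenous_pow_of_not_isSimple_of_charpoly_eq_cyclotomic_fifteen ((endRingInt P).neg_mem hA)
    (charpoly_neg_eq_cyclotomic_fifteen_of_charpoly_eq_cyclotomic_thirty hP) hns

/-- **EXACTLY FOUR COMPLEX TORI ADMIT AN ENDOMORPHISM OF CHARACTERISTIC POLYNOMIAL `Φ₃₀`** — the four tori of the `Φ₁₅` file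
(principal models `ℂ⁴/Φᵢ(𝓞)` of `ℚ(ζ₁₅)`, one simple, pairwise non-isogenous): every complex torus with `P_u = Φ₃₀` is isomorphic to
one of them (through `−u`). [cite: Shimura1998, §6.1 Thm. 2 p. 41, §7.4 Prop. 17 p. 58, §8.4 Examples (1)–(2)] [cite: BirkenhakeLange2004, §13.3]
[cite: Washington1997, Thm. 11.1] -/
theorem exists_four_forall_isIsomorphic_of_charpoly_eq_cyclotomic_thirty :
    ∃ Φ₁ Φ₂ Φ₃ Φ₄ : CMType (CyclotomicField 15 ℚ),
      ComplexTorus.IsSimple (periodIso Φ₁ (1 : (FractionalIdeal (𝓞 (CyclotomicField 15 ℚ))⁰ (CyclotomicField 15 ℚ))ˣ)) ∧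
      ¬ ComplexTorus.IsSimple (periodIso Φ₂ (1 : (FractionalIdeal (𝓞 (CyclotomicField 15 ℚ))⁰ (CyclotomicField 15 ℚ))ˣ)) ∧
      ¬ ComplexTorus.IsSimple (periodIso Φ₃ (1 : (FractionalIdeal (𝓞 (CyclotomicField 15 ℚ))⁰ (CyclotomicField 15 ℚ))ˣ)) ∧
      ¬ ComplexTorus.IsSimple (periodIso Φ₄ (1 : (FractionalIdeal (𝓞 (CyclotomicField 15 ℚ))⁰ (CyclotomicField 15 ℚ))ˣ)) ∧
      (∀ i ∈ ({(Φ₁, Φ₂), (Φ₁, Φ₃), (Φ₁, Φ₄), (Φ₂, Φ₃), (Φ₂, Φ₄), (Φ₃, Φ₄)} :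
          Set (CMType (CyclotomicField 15 ℚ) × CMType (CyclotomicField 15 ℚ))),
        ¬ IsIsogenous (periodIso i.1 (1 : (FractionalIdeal (𝓞 (CyclotomicField 15 ℚ))⁰ (CyclotomicField 15 ℚ))ˣ))
          (periodIso i.2 (1 : (FractionalIdeal (𝓞 (CyclotomicField 15 ℚ))⁰ (CyclotomicField 15 ℚ))ˣ))) ∧
      ∀ {ι : Type} [Fintype ι] [DecidableEq ι] {E : Type} [NormedAddCommGroup E] [NormedSpace ℂ E]
        (P : (ι → ℝ) ≃L[ℝ] E) {A : Matrix ι ι ℤ}, A ∈ endRingInt P → A.charpoly = cyclotomic 30 ℤ →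
        IsIsomorphic P (periodIso Φ₁ (1 : (FractionalIdeal (𝓞 (CyclotomicField 15 ℚ))⁰ (CyclotomicField 15 ℚ))ˣ)) ∨
        IsIsomorphic P (periodIso Φ₂ (1 : (FractionalIdeal (𝓞 (CyclotomicField 15 ℚ))⁰ (CyclotomicField 15 ℚ))ˣ)) ∨
        IsIsomorphic P (periodIso Φ₃ (1 : (FractionalIdeal (𝓞 (CyclotomicField 15 ℚ))⁰ (CyclotomicField 15 ℚ))ˣ)) ∨
        IsIsomorphic P (periodIso Φ₄ (1 : (FractionalIdeal (𝓞 (CyclotomicField 15 ℚ))⁰ (CyclotomicField 15 ℚ))ˣ)) := by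
  obtain ⟨Φ₁, Φ₂, Φ₃, Φ₄, h₁, h₂, h₃, h₄, hne, hall⟩ := exists_four_forall_isIsomorphic_of_charpoly_eq_cyclotomic_fifteen
  exact ⟨Φ₁, Φ₂, Φ₃, Φ₄, h₁, h₂, h₃, h₄, hne, fun P A hA hP ↦
    hall P ((endRingInt P).neg_mem hA) (charpoly_neg_eq_cyclotomic_fifteen_of_charpoly_eq_cyclotomic_thirty hP)⟩

/-- **`rank MT(X) = 5 ⟺ X` SIMPLE** for a complex torus with `P_u = Φ₃₀`. [cite: Dodson1984, §3.3.2 Theorem (p. 16)]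
[cite: MoonenZarhin1999LowDim, §1 (1.2)] -/
theorem mtRank_hodgeStructure_eq_five_iff_isSimple_of_charpoly_eq_cyclotomic_thirty [HodgeTensorFacts.{0, 0}]
    {A : Matrix ι ι ℤ} (hA : A ∈ endRingInt P) (hP : A.charpoly = cyclotomic 30 ℤ) :
    (hodgeStructure P 1).mtRank = 5 ↔ ComplexTorus.IsSimple P :=
  mtRank_hodgeStructure_eq_five_iff_isSimple_of_charpoly_eq_cyclotomic_fifteen ((endRingInt P).neg_mem hA)
    (charpoly_neg_eq_cyclotomic_fifteen_of_charpoly_eq_cyclotomic_thirty hP)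

/-- **THE HODGE CLASSES ON EVERY POWER OF EVERY COMPLEX TORUS WITH AN ENDOMORPHISM OF CHARACTERISTIC POLYNOMIAL `Φ₃₀` ARE
GENERATED BY DIVISOR CLASSES** (`Hdg(Xᵏ) = Div(Xᵏ)` for all `k`; through `−u`). [cite: MoonenZarhin1999LowDim, Thm. 0.1]
[cite: Dodson1984, §3.3.2 Theorem (p. 16)] [cite: BirkenhakeLange2004, §13.3] -/
theorem divisorClasses_powPeriod_eq_hodgeClasses_of_charpoly_eq_cyclotomic_thirty {A : Matrix ι ι ℤ} (hA : A ∈ endRingInt P)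
    (hP : A.charpoly = cyclotomic 30 ℤ) (k p : ℕ) :
    divisorClasses (powPeriod P k) p = hodgeClasses (powPeriod P k) p :=
  divisorClasses_powPeriod_eq_hodgeClasses_of_charpoly_eq_cyclotomic_fifteen ((endRingInt P).neg_mem hA)
    (charpoly_neg_eq_cyclotomic_fifteen_of_charpoly_eq_cyclotomic_thirty hP) k p

end Thirty

end ComplexTorus

end Literature.Geometry.Kaehler

end
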